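import Mathlib
import HarnessLib
import Literature.Analysis.FluidPDE.ClassicalSolution
import Literature.Analysis.FluidPDE.LerayHopf
import Literature.Analysis.FluidPDE.LerayHopfProofs
import Literature.Analysis.FluidPDE.ClassicalSolutionCalculus
import Literature.Analysis.FluidPDE.TaoLocalisation
import Literature.Analysis.FluidPDE.TaoLocalisationProofs
import Literature.Analysis.FluidPDE.TaoLocalisationHolds
import Literature.Analysis.FluidPDE.BKMClassTimeDerivativeL2
import Literature.Analysis.FluidPDE.LerayHopfDatumRebase
import Literature.Analysis.FunctionSpaces.TorusRieszFischerParam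
import Summits.NavierStokesRegularity.NavierStokesRegularity.Theses.QuarterJolt

/-!
# Route QuarterJolt — crux `NoTerminalJolt` (stmt-NavierStokesRegularity-26463), line `regular_split`,
# stub `stub_regularTime`: at a REGULAR time the jolt functional is `O((T−t)^{3/2})`

Seat ns-ntj-p1 g0 (LEAD on the crux; director-ns g13 req148); line of record
`Cruxes/NoTerminalJolt/Lines/regular_split.lean` (skeleton `NoTerminalJolt_of` = case split on
`HasSmoothExtensionPast ν 0 u T` into `stub_regularTime` (this file) and `stub_maximalTime` (the open
residue: the crux at a first blow-up time)). Statement audit of record: refuter-ns-regularity-refuter1-g10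
(item note 2026-08-28T08:15:53Z: «∀ T > 0 — T is ANY positive time … at a non-maximal T the claim is TRUE
and provable»).

THE STATEMENT (`NoTerminalJolt.stub_regularTime`, literally the body of `RegularTimeJolt` in the line file).
Let `ν > 0`, `T > 0`, `(u, p)` a classical solution of the unforced Navier–Stokes system on `ℝ³ × [0, T)`,
Leray–Hopf on `[0, T]` from its rapidly decaying datum, which EXTENDS SMOOTHLY PAST `T`
(`HasSmoothExtensionPast ν 0 u T`). Then the jolt functional `D(t) = (√(T−t))⁻¹ ∫ ‖u(t) − u(T)‖²` tends
to `0` as `t ↑ T` (in fact `D(t) ≤ Λ (T−t)^{3/2}`).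

PROOF.
1. *Finite energy of the extension on the closed slab.* Any classical extension `u'` on `[0, T')`,
   `T' > T`, is classical on `[0, T]` (`IsClassicalNSSolutionOn.mono`); for `t < T`, `u'(t) = u(t)` has
   `∫|u'(t)|² ≤ 2E(u₀)` (Leray–Hopf energy inequality, `IsLerayHopfOn.lintegral_enorm_sq_le`); at `t = T`
   the same bound follows by Fatou along `tₙ ↑ T` (joint continuity of `u'`).
   [The extension may be unphysical AFTER `T` — classical solutions without decay are not unique — so
   nothing about `u'` on `(T, T')` is ever used.]
2. *Tao 2013, Cor. 11.1* (tree THEOREM `tao2011_hasBoundedSobolevNormsOn_holds`): finite energy on the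
   CLOSED slab + rapidly decaying datum ⇒ `u'` is in the Beale–Kato–Majda class on `[0, T]`.
3. *Majda–Bertozzi Thm. 3.5, order 0* (tree theorem
   `IsClassicalNSSolutionOn.exists_lintegral_enorm_sub_sq_le`): in that class `t ↦ u'(t)` is Lipschitz
   into `L²`: `∫|u'(t) − u'(s)|² ≤ Λ (t − s)²` on `[0, T]`, `Λ < ∞`.
4. *The Leray–Hopf terminal value is the smooth one.* `u(t) ⇀ u(T)` weakly in `L²` as `t ↑ T` (field
   `weak_continuous` on `(0, T]`; `𝓝[<] T = 𝓝[(0,T)] T`), while `u(t) = u'(t) → u'(T)` strongly in `L²`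
   by step 3; limits of pairings are unique, so `∫⟪u(T) − u'(T), w⟫ = 0` for every `w ∈ L²`, and
   `w = u(T) − u'(T)` gives `u(T) = u'(T)` a.e.
5. Hence `∫‖u(t) − u(T)‖² = ∫‖u'(t) − u'(T)‖² ≤ Λ (T−t)²` for `t ∈ (0, T)` and
   `0 ≤ D(t) ≤ Λ (T−t) √(T−t) → 0`.

HONEST FRAMING: this is the DECIDABLE half of the crux (regular times); the crux at a first blow-up time
(`stub_maximalTime`, ⟺ «no blow-up» modulo the shelf crux `EnstrophyQuarterLaw` by the route's landed
supports) stays OPEN, as do `EnstrophyQuarterLaw`, `NoTerminalJolt` and Navier–Stokes regularity. No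
summit statement is proved here. [folklore]
-/

noncomputable section

-- the summit and its single sub-problem share the name (CONVENTIONS §1), as in every Theorems file
set_option linter.dupNamespace false

namespace Summit.NavierStokesRegularity.NavierStokesRegularity.Theorems

open MeasureTheory Set Function Filter Topology
open scoped NNReal ENNReal InnerProductSpace RealInnerProductSpace
open Literature.Analysis.FluidPDE

namespace NoTerminalJolt

/-! ### Step 1: finite energy of a classical extension on the closed slab -/

/-- **Energy of the extension on the closed slab.** If `u'` is a classical solution on `[0, T')`,
`T < T'`, agreeing with the Leray–Hopf solution `u` (datum `u 0`, no force, `ν ≥ 0`) on `[0, T)`, then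
`∫ |u'(t)|² ≤ 2 E(u 0)` for every `t ∈ [0, T]`: the Leray–Hopf energy inequality for `t < T`, Fatou's
lemma along `tₙ = T − T/(n+2) ↑ T` at `t = T` (the slices converge pointwise by joint continuity). -/
theorem lintegral_enorm_sq_le_of_extension {ν T T' : ℝ} (hν : 0 ≤ ν) (hT : 0 < T) (hTT' : T < T')
    {u u' : ℝ → EuclideanSpace ℝ (Fin 3) → EuclideanSpace ℝ (Fin 3)}
    {p' : ℝ → EuclideanSpace ℝ (Fin 3) → ℝ}
    (hsol' : IsClassicalNSSolutionOn (Ico 0 T') ν 0 u' p') (hagree : ∀ t ∈ Ico 0 T, u' t = u t)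
    (hLH : IsLerayHopfOn T ν 0 (u 0) u) :
    ∀ t ∈ Icc 0 T, ∫⁻ x, ‖u' t x‖ₑ ^ 2 ≤
      ENNReal.ofReal (2 * VectorCalculus.kineticEnergy (u 0)) := by
  intro t ht
  rcases lt_or_eq_of_le ht.2 with htT | rfl
  · rw [hagree t ⟨ht.1, htT⟩]
    exact hLH.lintegral_enorm_sq_le hν ⟨ht.1, htT.le⟩
  · -- `t = T`: Fatou along an interior sequence
    set C : ℝ≥0∞ := ENNReal.ofReal (2 * VectorCalculus.kineticEnergy (u 0)) with hC
    set s : ℕ → ℝ := fun n => t - t / ((n : ℝ) + 2) with hs_def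
    have hs : ∀ n, s n ∈ Ioo 0 t := by
      intro n
      have hn : (2 : ℝ) ≤ (n : ℝ) + 2 := by
        have : (0 : ℝ) ≤ n := Nat.cast_nonneg n
        linarith
      have hn0 : (0 : ℝ) < (n : ℝ) + 2 := by linarith
      refine ⟨?_, ?_⟩
      · show 0 < t - t / ((n : ℝ) + 2)
        have h1 : t / ((n : ℝ) + 2) ≤ t / 2 := div_le_div_of_nonneg_left hT.le (by norm_num) hn
        linarith
      · show t - t / ((n : ℝ) + 2) < t
        have h1 : 0 < t / ((n : ℝ) + 2) := div_pos hT hn0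
        linarith
    have hst : Tendsto s atTop (𝓝 t) := by
      have h1 : Tendsto (fun n : ℕ => t / ((n : ℝ) + 2)) atTop (𝓝 0) := by
        refine tendsto_const_nhds.div_atTop ?_
        exact tendsto_atTop_add_const_right _ _ tendsto_natCast_atTop_atTop
      simpa using (tendsto_const_nhds (x := t)).sub h1
    have hbound : ∀ n, ∫⁻ x, ‖u' (s n) x‖ₑ ^ 2 ≤ C := by
      intro n
      rw [hagree (s n) ⟨(hs n).1.le, (hs n).2⟩]
      exact hLH.lintegral_enorm_sq_le hν ⟨(hs n).1.le, (hs n).2.le⟩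
    -- pointwise convergence of the slices by joint continuity of `u'` on `[0, T') × ℝ³`
    have hcont : ContinuousOn (uncurry u') (Ico 0 T' ×ˢ univ) := hsol'.smooth_velocity.continuousOn
    have hpt : ∀ x, Tendsto (fun n => ‖u' (s n) x‖ₑ ^ 2) atTop (𝓝 (‖u' t x‖ₑ ^ 2)) := by
      intro x
      have hmem : (t, x) ∈ Ico 0 T' ×ˢ (univ : Set (EuclideanSpace ℝ (Fin 3))) :=
        mk_mem_prod ⟨hT.le, hTT'⟩ (mem_univ x)
      have hseq : Tendsto (fun n => (s n, x)) atTop (𝓝[Ico 0 T' ×ˢ univ] (t, x)) :=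
        tendsto_nhdsWithin_iff.2 ⟨hst.prodMk_nhds tendsto_const_nhds,
          Eventually.of_forall fun n =>
            mk_mem_prod ⟨(hs n).1.le, (hs n).2.trans hTT'⟩ (mem_univ x)⟩
      have h1 : Tendsto (fun n => uncurry u' (s n, x)) atTop (𝓝 (uncurry u' (t, x))) :=
        (hcont (t, x) hmem).tendsto.comp hseq
      exact ((ENNReal.continuous_pow 2).tendsto _).comp ((continuous_enorm.tendsto _).comp h1)
    have hmeas : ∀ n, AEMeasurable (fun x => ‖u' (s n) x‖ₑ ^ 2) volume := fun n =>
      (((ENNReal.continuous_pow 2).comp continuous_enorm).comp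
        (hsol'.contDiff_velocity ⟨(hs n).1.le, (hs n).2.trans hTT'⟩).continuous).aemeasurable
    calc ∫⁻ x, ‖u' t x‖ₑ ^ 2 = ∫⁻ x, liminf (fun n => ‖u' (s n) x‖ₑ ^ 2) atTop :=
          lintegral_congr fun x => ((hpt x).liminf_eq).symm
      _ ≤ liminf (fun n => ∫⁻ x, ‖u' (s n) x‖ₑ ^ 2) atTop := lintegral_liminf_le' hmeas
      _ ≤ C := liminf_le_of_frequently_le' (Eventually.of_forall hbound).frequently

/-! ### Steps 2–5: the regular-time jolt law -/

/-- For an `L²` field the Bochner integral of `‖f‖²` is the real part of the lower integral: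
`∫ ‖f‖² = (∫⁻ ‖f‖ₑ²).toReal` (the tree's `eEnergy_eq_ofReal`, unfolded). -/
theorem integral_norm_sq_eq_toReal_lintegral
    {f : EuclideanSpace ℝ (Fin 3) → EuclideanSpace ℝ (Fin 3)} (hf : MemLp f 2 volume) :
    ∫ x, ‖f x‖ ^ 2 = (∫⁻ x, ‖f x‖ₑ ^ 2).toReal := by
  have h := eEnergy_eq_ofReal f hf
  rw [eEnergy, VectorCalculus.kineticEnergy, ← mul_assoc, mul_inv_cancel₀ two_ne_zero, one_mul] at h
  rw [h, ENNReal.toReal_ofReal (integral_nonneg fun _ => sq_nonneg _)]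

/-- Two `L²` fields with the same pairings against every `L²` field agree a.e. (test with their
difference: `∫ ‖f − g‖² = 0`). -/
theorem ae_eq_of_forall_integral_inner_eq
    {f g : EuclideanSpace ℝ (Fin 3) → EuclideanSpace ℝ (Fin 3)} (hf : MemLp f 2 volume)
    (hg : MemLp g 2 volume)
    (h : ∀ w : EuclideanSpace ℝ (Fin 3) → EuclideanSpace ℝ (Fin 3), MemLp w 2 volume →
      ∫ x, ⟪f x, w x⟫ = ∫ x, ⟪g x, w x⟫) :
    f =ᵐ[volume] g := by
  have hw : MemLp (f - g) 2 volume := hf.sub hg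
  have h0 : ∫ x, ⟪(f - g) x, (f - g) x⟫ = 0 := by
    have h1 : ∫ x, ⟪(f - g) x, (f - g) x⟫ =
        (∫ x, ⟪f x, (f - g) x⟫) - ∫ x, ⟪g x, (f - g) x⟫ := by
      rw [← integral_sub (integrable_inner_of_memLp_two hf hw) (integrable_inner_of_memLp_two hg hw)]
      refine integral_congr_ae (Eventually.of_forall fun x => ?_)
      simp only [Pi.sub_apply, inner_sub_left]
    rw [h1, h (f - g) hw, sub_self]
  have hsq : ∫ x, ‖(f - g) x‖ ^ 2 = 0 := by
    rw [← h0]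
    refine integral_congr_ae (Eventually.of_forall fun x => ?_)
    simp only [real_inner_self_eq_norm_sq]
  have hint : Integrable (fun x => ‖(f - g) x‖ ^ 2) volume := hw.integrable_norm_pow two_ne_zero
  have hae := (integral_eq_zero_iff_of_nonneg (fun x => sq_nonneg _) hint).1 hsq
  filter_upwards [hae] with x hx
  have hx' : ‖(f - g) x‖ = 0 := pow_eq_zero_iff two_ne_zero |>.1 hx
  exact sub_eq_zero.1 (norm_eq_zero.1 hx')

/-- **The regular-time jolt law** (stub `stub_regularTime` of line `regular_split`, with the binders of
the frame as named hypotheses): if the classical Leray–Hopf solution extends smoothly past `T`, then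
`(√(T−t))⁻¹ ∫ ‖u(t) − u(T)‖² → 0` as `t ↑ T`. See the module docstring for the five steps. -/
theorem tendsto_joltFunctional_of_hasSmoothExtensionPast {ν T : ℝ} (hν : 0 < ν) (hT : 0 < T)
    {u : ℝ → EuclideanSpace ℝ (Fin 3) → EuclideanSpace ℝ (Fin 3)}
    {p : ℝ → EuclideanSpace ℝ (Fin 3) → ℝ}
    (_hcl : IsClassicalNSSolutionOn (Ico 0 T) ν 0 u p) (hLH : IsLerayHopfOn T ν 0 (u 0) u)
    (hdec : HasRapidSpatialDecay (u 0)) (hext : HasSmoothExtensionPast ν 0 u T) :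
    Tendsto (fun t : ℝ => (Real.sqrt (T - t))⁻¹ * ∫ x, ‖u t x - u T x‖ ^ 2)
      (𝓝[<] T) (𝓝 0) := by
  obtain ⟨T', hTT', u', p', hsol', hagree⟩ := hext
  -- Step 1–2: the extension on the closed slab is in the BKM class
  have hsolT : IsClassicalNSSolutionOn (Icc 0 T) ν 0 u' p' :=
    hsol'.mono (Icc_subset_Ico_right hTT') (uniqueDiffOn_Icc hT)
  have hE := lintegral_enorm_sq_le_of_extension hν.le hT hTT' hsol' hagree hLH
  have hE' : ∃ C : ℝ≥0, ∀ t ∈ Icc 0 T, ∫⁻ x, ‖u' t x‖ₑ ^ 2 ≤ C :=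
    ⟨(2 * VectorCalculus.kineticEnergy (u 0)).toNNReal, fun t ht => (hE t ht).trans le_rfl⟩
  have h0' : HasRapidSpatialDecay (u' 0) := by
    rw [hagree 0 ⟨le_rfl, hT⟩]
    exact hdec
  have hB : HasBoundedSobolevNormsOn (Icc 0 T) u' :=
    tao2011_hasBoundedSobolevNormsOn_holds hν hT hsolT hE' h0'
  -- Step 3: `L²`-Lipschitz continuity in time on `[0, T]`
  obtain ⟨Λ, hΛtop, hΛ⟩ := hsolT.exists_lintegral_enorm_sub_sq_le hν.le hT hB
  have hTmem : T ∈ Icc 0 T := ⟨hT.le, le_rfl⟩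
  have hmem' : ∀ t ∈ Icc 0 T, MemLp (u' t) 2 volume := fun t ht =>
    Literature.Analysis.FunctionSpaces.Torus.memLp_two_of_lintegral_enorm_sq
      (hsolT.contDiff_velocity ht).continuous.aestronglyMeasurable
      ((hE t ht).trans_lt ENNReal.ofReal_lt_top).ne
  -- strong `L²` convergence `u'(t) → u'(T)` as `t ↑ T`
  have hstrong : Tendsto (fun t => eLpNorm (u' t - u' T) 2 volume) (𝓝[<] T) (𝓝 0) := by
    have hup : ∀ᶠ t in 𝓝[<] T, eLpNorm (u' t - u' T) 2 volume ≤
        (ENNReal.ofReal ((T - t) ^ 2) * Λ) ^ (1 / 2 : ℝ) := by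
      filter_upwards [Ioo_mem_nhdsLT hT] with t ht
      have h1 := hΛ t ⟨ht.1.le, ht.2.le⟩ T hTmem ht.2.le
      have h2 : ∫⁻ x, ‖(u' t - u' T) x‖ₑ ^ 2 ≤ ENNReal.ofReal ((T - t) ^ 2) * Λ := by
        refine le_of_eq_of_le (lintegral_congr fun x => ?_) h1
        rw [Pi.sub_apply, ← enorm_neg, neg_sub]
      exact eLpNorm_two_le_rpow_of_lintegral_sq_le h2
    have hlim : Tendsto (fun t : ℝ => (ENNReal.ofReal ((T - t) ^ 2) * Λ) ^ (1 / 2 : ℝ))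
        (𝓝[<] T) (𝓝 0) := by
      have h1 : Tendsto (fun t : ℝ => (T - t) ^ 2) (𝓝[<] T) (𝓝 0) := by
        have hc : Continuous fun t : ℝ => (T - t) ^ 2 := (continuous_const.sub continuous_id).pow 2
        have := hc.tendsto T
        simp only [sub_self, zero_pow two_ne_zero] at this
        exact this.mono_left nhdsWithin_le_nhds
      have h2 : Tendsto (fun t : ℝ => ENNReal.ofReal ((T - t) ^ 2)) (𝓝[<] T) (𝓝 0) := by
        simpa only [ENNReal.ofReal_zero] using ENNReal.tendsto_ofReal h1
      have h3 : Tendsto (fun t : ℝ => ENNReal.ofReal ((T - t) ^ 2) * Λ) (𝓝[<] T) (𝓝 0) := by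
        simpa only [zero_mul] using ENNReal.Tendsto.mul_const h2 (Or.inr hΛtop)
      have h4 := ((ENNReal.continuous_rpow_const (y := (1 / 2 : ℝ))).tendsto (0 : ℝ≥0∞)).comp h3
      simpa only [Function.comp_def, ENNReal.zero_rpow_of_pos (by norm_num : (0 : ℝ) < 1 / 2)]
        using h4
    exact tendsto_of_tendsto_of_tendsto_of_le_of_le' tendsto_const_nhds hlim
      (Eventually.of_forall fun _ => zero_le) hup
  -- Step 4: the Leray–Hopf terminal value equals the smooth one a.e.
  have hle_filter : 𝓝[<] T ≤ 𝓝[Ioc 0 T] T := by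
    rw [← nhdsWithin_Ioo_eq_nhdsLT hT]
    exact nhdsWithin_mono _ Ioo_subset_Ioc_self
  have hpair : ∀ w : EuclideanSpace ℝ (Fin 3) → EuclideanSpace ℝ (Fin 3), MemLp w 2 volume →
      ∫ x, ⟪u T x, w x⟫ = ∫ x, ⟪u' T x, w x⟫ := by
    intro w hw
    have h1 : Tendsto (fun t => ∫ x, ⟪u t x, w x⟫) (𝓝[<] T) (𝓝 (∫ x, ⟪u T x, w x⟫)) :=
      (((hLH.weak_continuous w hw).1) T ⟨hT, le_rfl⟩).tendsto.mono_left hle_filter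
    have hev : ∀ᶠ t in 𝓝[<] T, MemLp (u' t) 2 volume := by
      filter_upwards [Ioo_mem_nhdsLT hT] with t ht
      exact hmem' t ⟨ht.1.le, ht.2.le⟩
    have h2' := Literature.Analysis.FluidPDE.Torus.tendsto_integral_inner_of_tendsto_eLpNorm_sub
      (hmem' T hTmem) hw hev hstrong
    have h2 : Tendsto (fun t => ∫ x, ⟪u t x, w x⟫) (𝓝[<] T) (𝓝 (∫ x, ⟪u' T x, w x⟫)) := by
      refine h2'.congr' ?_
      filter_upwards [Ioo_mem_nhdsLT hT] with t ht
      rw [hagree t ⟨ht.1.le, ht.2⟩]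
    exact tendsto_nhds_unique h1 h2
  have hae : u T =ᵐ[volume] u' T :=
    ae_eq_of_forall_integral_inner_eq (hLH.memLp T hTmem) (hmem' T hTmem) hpair
  -- Step 5: the bound `D(t) ≤ Λ (T - t) √(T - t)` on `(0, T)` and the squeeze
  have hbound : ∀ᶠ t in 𝓝[<] T, (Real.sqrt (T - t))⁻¹ * ∫ x, ‖u t x - u T x‖ ^ 2 ≤
      (T - t) * Real.sqrt (T - t) * Λ.toReal := by
    filter_upwards [Ioo_mem_nhdsLT hT] with t ht
    have htI : t ∈ Icc 0 T := ⟨ht.1.le, ht.2.le⟩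
    have hδ : 0 < T - t := sub_pos.2 ht.2
    have hsq : 0 < Real.sqrt (T - t) := Real.sqrt_pos.2 hδ
    have hint_eq : ∫ x, ‖u t x - u T x‖ ^ 2 = ∫ x, ‖(u' T - u' t) x‖ ^ 2 := by
      refine integral_congr_ae ?_
      filter_upwards [hae] with x hx
      rw [hx, ← hagree t ⟨ht.1.le, ht.2⟩, Pi.sub_apply, norm_sub_rev]
    have hle : ∫ x, ‖(u' T - u' t) x‖ ^ 2 ≤ (T - t) ^ 2 * Λ.toReal := by
      have h1 := hΛ t htI T hTmem ht.2.le
      have hg : MemLp (u' T - u' t) 2 volume := (hmem' T hTmem).sub (hmem' t htI)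
      rw [integral_norm_sq_eq_toReal_lintegral hg, ← ENNReal.toReal_ofReal (sq_nonneg (T - t)),
        ← ENNReal.toReal_mul]
      exact ENNReal.toReal_mono (ENNReal.mul_ne_top ENNReal.ofReal_ne_top hΛtop)
        (le_of_eq_of_le (lintegral_congr fun x => by rw [Pi.sub_apply]) h1)
    calc (Real.sqrt (T - t))⁻¹ * ∫ x, ‖u t x - u T x‖ ^ 2
        ≤ (Real.sqrt (T - t))⁻¹ * ((T - t) ^ 2 * Λ.toReal) := by
          rw [hint_eq]
          exact mul_le_mul_of_nonneg_left hle (inv_nonneg.2 hsq.le)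
      _ = (T - t) * Real.sqrt (T - t) * Λ.toReal := by
          rw [inv_mul_eq_iff_eq_mul₀ hsq.ne']
          have e : Real.sqrt (T - t) * ((T - t) * Real.sqrt (T - t) * Λ.toReal) =
              (T - t) * (Real.sqrt (T - t) * Real.sqrt (T - t)) * Λ.toReal := by ring
          rw [e, Real.mul_self_sqrt hδ.le]
          ring
  have hupper : Tendsto (fun t : ℝ => (T - t) * Real.sqrt (T - t) * Λ.toReal) (𝓝[<] T) (𝓝 0) := by
    have hc : Continuous fun t : ℝ => (T - t) * Real.sqrt (T - t) * Λ.toReal :=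
      ((continuous_const.sub continuous_id).mul
        ((continuous_const.sub continuous_id).sqrt)).mul continuous_const
    have := hc.tendsto T
    simp only [sub_self, zero_mul] at this
    exact this.mono_left nhdsWithin_le_nhds
  refine tendsto_of_tendsto_of_tendsto_of_le_of_le' tendsto_const_nhds hupper
    (Eventually.of_forall fun t => ?_) hbound
  exact mul_nonneg (inv_nonneg.2 (Real.sqrt_nonneg _)) (integral_nonneg fun _ => sq_nonneg _)

/-- **stub `stub_regularTime` of line `regular_split`, VERBATIM** (the body of `RegularTimeJolt` in
`Cruxes/NoTerminalJolt/Lines/regular_split.lean`): in the frame of the crux `NoTerminalJolt`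
(classical on `[0,T)`, Leray–Hopf on `[0,T]`, rapidly decaying datum), if the solution extends smoothly
past `T` then the jolt functional tends to `0` as `t ↑ T`. The regular-time half of the crux; the
maximal-time half stays open. -/
theorem stub_regularTime :
    ∀ (ν T : ℝ), 0 < ν → 0 < T → ∀ (u : ℝ → EuclideanSpace ℝ (Fin 3) → EuclideanSpace ℝ (Fin 3))
      (p : ℝ → EuclideanSpace ℝ (Fin 3) → ℝ), IsClassicalNSSolutionOn (Set.Ico 0 T) ν 0 u p →
      IsLerayHopfOn T ν 0 (u 0) u → HasRapidSpatialDecay (u 0) → HasSmoothExtensionPast ν 0 u T →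
      Filter.Tendsto (fun t : ℝ => (Real.sqrt (T - t))⁻¹ * ∫ x, ‖u t x - u T x‖ ^ 2)
        (nhdsWithin T (Set.Iio T)) (nhds 0) :=
  fun _ν _T hν hT _u _p hcl hLH hdec hext =>
    tendsto_joltFunctional_of_hasSmoothExtensionPast hν hT hcl hLH hdec hext

end NoTerminalJolt

/-- **`NoTerminalJolt` holds at every regular time** (the crux `Theses.QuarterJolt.NoTerminalJolt` with
the extra hypothesis `HasSmoothExtensionPast ν 0 u T`; equivalently, the crux is equivalent to its
restriction to maximal times `IsMaximalSmoothSolution ν 0 u p T`). Route-level reading of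
`NoTerminalJolt.stub_regularTime`. -/
theorem noTerminalJolt_of_hasSmoothExtensionPast {ν T : ℝ} (hν : 0 < ν) (hT : 0 < T)
    {u : ℝ → EuclideanSpace ℝ (Fin 3) → EuclideanSpace ℝ (Fin 3)}
    {p : ℝ → EuclideanSpace ℝ (Fin 3) → ℝ}
    (hcl : IsClassicalNSSolutionOn (Ico 0 T) ν 0 u p) (hLH : IsLerayHopfOn T ν 0 (u 0) u)
    (hdec : HasRapidSpatialDecay (u 0)) (hext : HasSmoothExtensionPast ν 0 u T) :
    Tendsto (fun t : ℝ => (Real.sqrt (T - t))⁻¹ * ∫ x, ‖u t x - u T x‖ ^ 2)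
      (𝓝[<] T) (𝓝 0) :=
  NoTerminalJolt.tendsto_joltFunctional_of_hasSmoothExtensionPast hν hT hcl hLH hdec hext

end Summit.NavierStokesRegularity.NavierStokesRegularity.Theorems

end
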